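import Literature.MathematicalPhysics.QuantumFieldTheory.Balaban1983to89.B9Eq387CubeReductionClosed
import Literature.MathematicalPhysics.QuantumFieldTheory.Balaban1983to89.B9Eq315QLipschitzL2
import Literature.MathematicalPhysics.QuantumFieldTheory.Balaban1983to89.B9Eq384RemainderLetters
import Literature.MathematicalPhysics.QuantumFieldTheory.Balaban1983to89.NodeOTorusLemma24
import Literature.MathematicalPhysics.QuantumFieldTheory.Balaban1983to89.NodeOFlatAxial

/-!
# `Balaban1983to89.NodeOLocAxial` — T. Bałaban, *Propagators for lattice gauge theories in a background field*, CMP **99** (1985) 389–434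
# [Balaban1985BackgroundPropagators] p. 428 «Localizing the operators in Δ_k and using the methods of Sect. B we can prove it for C*Δ_kC with an arbitrary
# configuration U», (3.26)–(3.30) p. 395, (3.35)–(3.36) p. 396, with [Balaban1984PropagatorsII] Lemma 2.4 p. 245 and [Balaban1985Averaging] (124)∕(126) p. 36:
# **THE LOCAL STEP OF THE `γ₀` ROAD (E1 Lemma 5.5) AT EVERY BLOCK-REGULAR BACKGROUND, FROM TREE THEOREMS — per-cube axial coercivity of `‖∂_V A‖² + a‖Q(V)A‖²`
# with `γ = γ_f∕2 − (C_D² + a·C_Q²)`, `γ_f = (κ₁∕(12d²))·L^{−(d+1)}·min{η⁻², a·c₁∕(c₀L^{d−2})}` EXPLICIT**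

statement-level skeleton of published theorems with citation tags; proofs where landed; nothing here is a claim about the Yang–Mills mass gap

CITATION HEADER (lean-in-tree rule).  Ideation cell `ym-nodeO-ideate` (portfolio track, 2026-08-25), seat P1 «inside Bałaban», memo
`memos/ROUTE-P1.md` v3.17 (sha256 d4d6d9a6…) §0q (FINDINGS F10∕F11) and §0p (F9).  LANDING EDITION (generation 12, F-series module 5∕5) of the memo
companion `memos/ROUTE-P1-SketchLocAxial.lean` («companion 6′», sha256 ab79b22d…, 318 l., 0 `sorry`; REF g22 PASS 2026-08-25T19:11:13Z on companion 6 = 6′ but two comment strings)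
ENTIRE, plus the three composition theorems `hloc_axial_of_Rreal` ∕ `hloc_axial_of_torus2128` ∕ `hloc_axial_of_lemma24` of the certificate `memos/ROUTE-P1-TestCompose678.lean`
(sha256 e3af6305…, :1336, :1360, :1388); referee track = the cell's `STATUS.md` (REF∕LIT verdict lines on v3.17 and on this edition are the filing precondition; the courier files
REF-named editions only, unchanged; director-ym LINE №2 (B), operator 2026-08-25T18:24:34Z).  Statements and proofs below are CHARACTER-IDENTICAL to the
companion's; edition deltas = the namespace (`YMNodeOIdeate.P1.LocAxialRoad` → this module's), this header, the imports of modules 2 and 4 (`NodeOTorusLemma24`, `NodeOFlatAxial`) next to the companion's three, the three composition theorems appended inside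
`section Cube` (new §3) with their cross-references re-pointed to modules 1∕2∕4 (`NodeOTorusBlocks.curlSum∕qSum∕axialTrees`, `NodeOTorusLemma24.torus2128_of_Zd`, `NodeOFlatAxial.Rreal_of_unitWeight`), the companion's `open …Balaban1983to89` line dropped
(the opens now resolve inside the tree namespace), bare `Plaq`∕`block` spelled `B9SectCLatticeCarrier.Plaq`∕`B6Elimination.block` in code (inside the tree
namespace the topic root's `Setup.lean` `Plaq`∕`block` shadow the opens),
for the gate lint `literature-cited-only` (LIT pre-flight 2026-08-25T20:35:30Z: `[folklore]` alone only on private helpers) 1 same-module helper(s) marked `private` (`half_sq_sub_le`), and nothing else.  EACH `[cite:]` TAG NAMES THE PRINTED DISPLAY THE DECLARATION SERVES OR TRANSCRIBES —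
the proofs are finite-sum bookkeeping ∕ linear algebra of ours; print proves none of them as stated.  Sources READ (renders, LIT `lit/SOURCES.md` v2.75):
[Balaban1985BackgroundPropagators] pp. 395–396, p. 428; [Balaban1984PropagatorsII] = CMP **96** p. 245; [Balaban1985Averaging] p. 36; [Balaban1989LargeFieldII] = CMP **122** pp. 357–358 (via LIT §1.14,
by reference); E1 = `pub-balaban/b2b-balaban-r1/SectE-interface-proof.md` §5.5 ll. 82–85.

LABELS in the docstrings below (memo-side words, NOT tree declarations): «E1» = the written repair `pub-balaban/b2b-balaban-r1/SectE-interface-proof.md`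
(Lemma 5.5 ll. 83–85, Prop. 5.6 ll. 86–88); «(loc)», «J1a», «(h2)», «hflat», «Rreal» = memo rows (§0p.3, §0q); «companion 5» ∕ «N9:n» = the memo companion
`memos/ROUTE-P1-SketchLettersNE9.lean` line n (its `h2_of_loc` :722 is the IMS assembly that consumes the (loc) binder; not landed); «NODE O» = :353.
PRINT STATUS.  The `γ₀` lower bound for arbitrary `U` is ASSERTED on p. 428 and PROVED NOWHERE in print (pub-balaban GAPS G-B9-09); E1 is a written repair modulo
printed inputs, and its Lemma 5.5 (the per-cube gauge step: gauge `V` to `|V^u − 1| ≤ ε_F` on a doubled cube by (3.35), compare `Q₁(V^u)`, `∂_{V^u}` with their flat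
versions by (124)∕(126), apply Lemma 2.4′) is NOT print.  Below, every analytic letter of that step is a TREE THEOREM consumed by name
(`B9Eq387CubeReductionGaugeBackground.exists_gauge_background_coarseCube`, `B9Eq315QLipschitzL2.norm_QtorusW_sub_flat_le_local`,
`B9Eq373DerivativeRemainderL2.norm_covCurlL2K_sub_le`, `B9Eq315QTorusLocality.QtorusW_gauge_transfer_of_support`, …), the flat input is modules 2∕4, and what this
module adds is the (ε)-algebra of the step.  PRINTED TEMPLATE of the method (flat form + first order in the background + axial Poincaré) for a DIFFERENT background∕scope:
[Balaban1989LargeFieldII] (1.7)–(1.9) pp. 357–358 (minimizer background on one `100M`-region, `M`-dependent constant; tree `B16Sect1Wilson.Ineq17`–`Ineq19`, `B16Ineq17Assembly.ineq17_of_pert`;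
LIT `lit/SOURCES.md` §1.14) — precedent only, nothing of it is consumed here; G-B9-09 is unaltered (no printed proof for the (3.35)–(3.36) backgrounds uniform in `M`).

WHAT IS PROVED (sorry-free; standard axioms).  §0 `half_sq_sub_le`; §1 **`cube_axial_of_flat`** (one cube: (loc) from `hflat` and the tree's gauge∕Lipschitz letters);
§2 **`hloc_axial_of_flat`** (the (loc) binder of the IMS assembly for every cube of an admissible partition), `hgeo_of_partition`, `hloc_axial_of_flat₀`, `hR_unitary`;
§3 `hloc_axial_of_Rreal` ((loc) from the real explicit-sum inequality `Rreal`), **`hloc_axial_of_torus2128`** ((loc) from the unit-weight torus (2.128) as a binder,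
any `T`) and **`hloc_axial_of_lemma24`** ((loc) with NO (2.128)-type binder for
`d ≥ 2` and `T ⊇ NodeOTorusBlocks.axialTrees`, from `NodeOTorusLemma24.torus2128_of_Zd`; constant as in the title).

WHAT THIS IS NOT.  Not NODE O (`B13TermWalkDataOneTorus.ExistsUniformAcrossSmall`, :353), not [Balaban1987RG1] Thm 2 + (0.31) p. 259, not the `γ₀`
sentence of [Balaban1985BackgroundPropagators] p. 428 (whose road is `NodeOGamma0Road.hcoer_of_letters` MODULO its letters), not a new estimate: not (h2) (the IMS assembly `NodeOGamma0Road`∕E1 Prop. 5.6 consumes (loc) through a currency junction J0 not landed), not (h1), no large-field backgrounds, no `d < 2`.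
-/

noncomputable section

open scoped BigOperators InnerProductSpace ComplexConjugate

namespace Literature.MathematicalPhysics.QuantumFieldTheory.Balaban1983to89.NodeOLocAxial

open B4Sect5Torus (TSite tdist)
open B5TorusCover (Ctr)
open B5SmoothPartition (hS)
open B9SectCLatticeCarrier (Bond bpos)
open B7Prop1Explicit (e l1 U1 Wcx boxVec)
open B9Eq311L2Pairing (WL2)
open B9Eq319QprimeTorus (fineP blockCoord centre)
open B9Eq315QTorusOnto (liftSite)
open B9Eq310DeltaPrime (plaqHolU)
open B11Eq103H1Complex (BondL2K)
open B9Eq310HessianOperator (adTransportW covCurlL2K)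
open B9Eq315QTorus (perSite perCfg cornerSite QtorusW)
open B9Eq328GaugeAction (gaugeU gaugeW AdW norm_gaugeW equiv_gaugeW)
open B9Eq387CubeReductionGaugeBackground (exists_gauge_background_coarseCube)
open B9Eq387CubeReductionSmallField (norm_gaugeW_bond norm_curl_gauge)
open B9Eq315QTorusLocality (QtorusW_gauge_transfer_of_support)
open B9Eq387CubeProjectionLocality (covCurlL2K_congr_of_support adTransportW_congr)
open B9Eq335SmallBondsData (perCfg_mem_U1 hreg_of_small_bonds alpha_le_64)
open B9Eq373DerivativeRemainderL2 (norm_covCurlL2K_sub_le)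
open B9Eq333ProjectionCovariance (hreg_gaugeU)
open B7Eq44TorusAxialGauge (gaugeU_mem_U1)
open B9Eq315QLipschitzL2 (norm_QtorusW_sub_flat_le_local)
open B9Eq384RemainderLetters (norm_adTransportW_sub_le adTransportW_one_apply)

/-! ## §0 One elementary inequality -/

/-- `‖v‖²∕2 − ‖u − v‖² ≤ ‖u‖²` — from `‖v‖ ≤ ‖u‖ + ‖u − v‖` and `(s + t)² ≤ 2s² + 2t²`. [folklore] -/
private theorem half_sq_sub_le {E : Type*} [SeminormedAddCommGroup E] (u v : E) : ‖v‖ ^ 2 / 2 - ‖u - v‖ ^ 2 ≤ ‖u‖ ^ 2 := by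
  have h : ‖v‖ ≤ ‖u‖ + ‖u - v‖ := by
    calc ‖v‖ = ‖u - (u - v)‖ := by rw [sub_sub_cancel]
      _ ≤ ‖u‖ + ‖u - v‖ := norm_sub_le _ _
  have h2 : ‖v‖ ^ 2 ≤ (‖u‖ + ‖u - v‖) ^ 2 := pow_le_pow_left₀ (norm_nonneg _) h 2
  nlinarith [sq_nonneg (‖u‖ - ‖u - v‖), norm_nonneg u, norm_nonneg (u - v)]

/-! ## §1 E1 Lemma 5.5's gauge step on one coarse cube: (loc) at `V` from the flat axial inequality -/

section Cube

variable {d : ℕ} (L : ℕ) [NeZero L] (hL : 1 ≤ L) (m : Fin d → ℕ) [∀ i, NeZero (m i)] [∀ i, NeZero (fineP L m i)]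
  {𝔸 : Type*} [NormedRing 𝔸] [NormOneClass 𝔸] [StarMul 𝔸] [NormedAlgebra ℂ 𝔸] [CompleteSpace 𝔸]
  {W : Type*} [NormedAddCommGroup W] [InnerProductSpace ℂ W] (φ : W ≃ₗ[ℂ] 𝔸)
  (hAdU : ∀ u : 𝔸ˣ, star ((u : 𝔸ˣ) : 𝔸) = ((u⁻¹ : 𝔸ˣ) : 𝔸) → ∀ v v' : W, ⟪AdW φ u v, AdW φ u v'⟫_ℂ = ⟪v, v'⟫_ℂ)
  {Mφ Mφ' : ℝ} (hMφ : 0 ≤ Mφ) (hMφ' : 0 ≤ Mφ') (hφ : ∀ w, ‖φ w‖ ≤ Mφ * ‖w‖) (hφ' : ∀ X, ‖φ.symm X‖ ≤ Mφ' * ‖X‖)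
  {c₀ c₁ : ℝ} [Fact (0 < c₀)] [Fact (0 < c₁)] (η : ℝ)
  -- the background: unit-bounded, unitary, plaquette variables `δ`-close to `1`; ITS `Q`-witnesses (any) and the flat ones (any)
  (V : Bond d (fineP L m) → 𝔸ˣ) (hU : ∀ b, V b ∈ U1 𝔸) (hUstar : ∀ b, star ((V b : 𝔸ˣ) : 𝔸) = (((V b)⁻¹ : 𝔸ˣ) : 𝔸))
  {α : ℝ} (hα1 : α ≤ 1 / 64)
  (hU1 : ∀ (x : B7Prop1Explicit.Site d) (κ : Fin d), perCfg (fineP L m) V x κ ∈ U1 𝔸)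
  (hreg : ∀ (y : TSite d m) (κ : Fin d) (r : Fin d → Fin L),
    ‖((Wcx L (perCfg (fineP L m) V) (cornerSite L y) κ (boxVec L r) : 𝔸ˣ) : 𝔸) - 1‖ ≤ α)
  {α' : ℝ} (hα1' : α' ≤ 1 / 64)
  (hU1' : ∀ (x : B7Prop1Explicit.Site d) (κ : Fin d), perCfg (fineP L m) (fun _ : Bond d (fineP L m) => (1 : 𝔸ˣ)) x κ ∈ U1 𝔸)
  (hreg' : ∀ (y : TSite d m) (κ : Fin d) (r : Fin d → Fin L),
    ‖((Wcx L (perCfg (fineP L m) (fun _ : Bond d (fineP L m) => (1 : 𝔸ˣ))) (cornerSite L y) κ (boxVec L r) : 𝔸ˣ) : 𝔸) - 1‖ ≤ α')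
  {δ : ℝ} (hδ0 : 0 ≤ δ) (hδ : ∀ p : B9SectCLatticeCarrier.Plaq d (fineP L m), ‖(plaqHolU V p : 𝔸) - 1‖ ≤ δ)
set_option maxHeartbeats 400000 in
include hAdU hMφ hMφ' hφ hφ' hU hUstar hδ0 hδ in
/-- **E1 LEMMA 5.5, THE GAUGE STEP, ON ONE COARSE CUBE.**  Cube data: coarse corner `y₁`, extents `N` (`N_i + 4 ≤ m_i`, so the gauge box
`L·y₁ + [0, L(N+3)]` does not wrap), block set `Y ⊆ y₁ + [1, N+1]`; `ε_g := |L(N+3)|₁·δ ≤ 1∕(256(d+1)²L^{d+1})` (so `Q(Ũ)` is defined).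
Field data: `A` supported over `Y` (`hA`) and vanishing on the bond set `T` (`hAT`; E1: axial gauge on the `L`-blocks).  DISPLAYED: the flat
axial inequality `hflat` on this cube (J1a = [B6] Lemma 2.4′ at `U = 1`, constant `γ_f`; NOT proved here).  CONCLUSION:
`(γ_f∕2 − ((4√d·‖η⁻¹‖·2M_φM_φ′ε_g)² + a·(M_φ′M_φ√(2d c₁∕c₀)·102(d+1)²L·ε_g)²))·‖A‖² ≤ ‖curl_V A‖² + ‖√a•Q(V)A‖²`.
Proof: `(g, Ũ)` from `exists_gauge_background_coarseCube`; `‖curl_V A‖ = ‖curl_{V^g}A^g‖ = ‖curl_Ũ A^g‖`, `‖√a•Q(V)A‖ = ‖√a•Q(Ũ)A^g‖`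
(covariance + locality); `A^g` vanishes on `T` and off `Y` (the gauge acts fibrewise), `‖A^g‖ = ‖A‖`; the two Lipschitz letters at the
global window `ε_g` of `Ũ`; `hflat` at `A^g`; §0 twice.
[cite: Balaban1985BackgroundPropagators, (3.35) p.396, (3.28)–(3.33) pp.395–396, (3.4) p.391, (3.15)–(3.16) p.393, (3.70)–(3.73) pp.404–405,
Cor 3.6 p.408; Balaban1984PropagatorsII, Lemma 2.4 (2.128) p.245; Balaban1987RG1, (1.11)–(1.12) p.262] -/
theorem cube_axial_of_flat
    (y₁ : TSite d m) {N : B7Prop1Explicit.Site d} (hNm : ∀ i, N i + 4 ≤ (m i : ℤ)) (Y : Set (TSite d m))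
    (hY : ∀ y ∈ Y, ∀ i, 1 ≤ liftSite (y - y₁) i ∧ liftSite (y - y₁) i ≤ N i + 1)
    (hw : (l1 (fun i => (L : ℤ) * (N i + 3)) : ℝ) * δ ≤ 1 / (256 * ((d : ℝ) + 1) ^ 2 * (L : ℝ) ^ (d + 1)))
    (T : Set (Bond d (fineP L m))) {a γf : ℝ} (ha : 0 ≤ a)
    (hflat : ∀ A' : BondL2K ℂ d (fineP L m) c₀ W, (∀ b ∈ T, WL2.equiv ℂ _ W A' b = 0) →
      (∀ b : Bond d (fineP L m), blockCoord L m (bpos b) ∉ Y → WL2.equiv ℂ _ W A' b = 0) →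
      γf * ‖A'‖ ^ 2 ≤ ‖covCurlL2K ℂ c₀ ((η : ℂ))⁻¹ (adTransportW φ fun _ : Bond d (fineP L m) => (1 : 𝔸ˣ)) A'‖ ^ 2 +
        ‖((Real.sqrt a : ℝ) : ℂ) • QtorusW L m hL φ (fun _ : Bond d (fineP L m) => (1 : 𝔸ˣ)) hα1' hU1' hreg' (c₁ := c₁) A'‖ ^ 2)
    (A : BondL2K ℂ d (fineP L m) c₀ W) (hA : ∀ b : Bond d (fineP L m), blockCoord L m (bpos b) ∉ Y → WL2.equiv ℂ _ W A b = 0)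
    (hAT : ∀ b ∈ T, WL2.equiv ℂ _ W A b = 0) :
    (γf / 2 - ((4 * Real.sqrt d * (‖((η : ℂ))⁻¹‖ * (2 * Mφ * Mφ' * ((l1 (fun i => (L : ℤ) * (N i + 3)) : ℝ) * δ)))) ^ 2 +
        a * (Mφ' * Mφ * Real.sqrt (2 * d * c₁ / c₀) * (102 * (d + 1) ^ 2 * L * ((l1 (fun i => (L : ℤ) * (N i + 3)) : ℝ) * δ))) ^ 2)) * ‖A‖ ^ 2 ≤
      ‖covCurlL2K ℂ c₀ ((η : ℂ))⁻¹ (adTransportW φ V) A‖ ^ 2 + ‖((Real.sqrt a : ℝ) : ℂ) • QtorusW L m hL φ V hα1 hU1 hreg (c₁ := c₁) A‖ ^ 2 := by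
  have hm : ∀ i, 1 ≤ m i := fun i => Nat.one_le_iff_ne_zero.mpr (NeZero.ne (m i))
  have hEPS0 : 0 ≤ (l1 (fun i => (L : ℤ) * (N i + 3)) : ℝ) * δ := mul_nonneg (Nat.cast_nonneg _) hδ0
  -- the pair `(g, Ũ)` of the tree, with every letter
  obtain ⟨g, Ũ, hg1, _hgstar, hŨ1, _hŨstar, hŨε, _hŨ2, hagree, _hoff, hAd, _hRSŨ, _hconŨ, _hconŨinv⟩ :=
    exists_gauge_background_coarseCube L m φ hAdU hU hUstar y₁ hNm Y hY hδ0 (fun x κ μ hκμ _ => hδ _)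
  -- the gauged field: same support, same zero pattern, same norm
  set Ag : BondL2K ℂ d (fineP L m) c₀ W := gaugeW φ (fun b : Bond d (fineP L m) => g (bpos b)) A with hAg
  have hAg0 : ∀ b : Bond d (fineP L m), blockCoord L m (bpos b) ∉ Y → WL2.equiv ℂ (fun _ : Bond d (fineP L m) => c₀) W Ag b = 0 :=
    fun b hb => by rw [hAg, equiv_gaugeW, hA b hb, map_zero]
  have hAgT : ∀ b ∈ T, WL2.equiv ℂ (fun _ : Bond d (fineP L m) => c₀) W Ag b = 0 :=
    fun b hb => by rw [hAg, equiv_gaugeW, hAT b hb, map_zero]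
  have hnA : ‖Ag‖ = ‖A‖ := norm_gaugeW_bond L m φ c₀ g hAd A
  -- `Q`-witnesses of `Ũ` (global window `ε_g`) and of `V^g`
  have hα1Ũ := alpha_le_64 (d := d) hL hEPS0 hw
  have hU1Ũ := perCfg_mem_U1 L m hŨ1
  have hregŨ := hreg_of_small_bonds L m hŨ1 hEPS0 hŨε
  have hU1g : ∀ (x : B7Prop1Explicit.Site d) (κ : Fin d), perCfg (fineP L m) (gaugeU g V) x κ ∈ U1 𝔸 :=
    fun x κ => by rw [B9Eq315QTorus.perCfg_apply]; exact gaugeU_mem_U1 _ hU hg1 _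
  have hregg := hreg_gaugeU L m g V hg1 hreg
  -- the curl term: `‖curl_V A‖ = ‖curl_{V^g} A^g‖ = ‖curl_Ũ A^g‖`
  have hcurl : ‖covCurlL2K ℂ c₀ ((η : ℂ))⁻¹ (adTransportW φ Ũ) Ag‖ = ‖covCurlL2K ℂ c₀ ((η : ℂ))⁻¹ (adTransportW φ V) A‖ := by
    rw [← norm_curl_gauge L m φ c₀ η V g hAd A, ← hAg]
    rw [covCurlL2K_congr_of_support L m hm ((η : ℂ))⁻¹ Y (fun b hb => adTransportW_congr φ (hagree b hb)) Ag hAg0]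
  -- the `Q` term: `Q(Ũ)A^g = R(g₁)(Q(V)A)`, an isometry
  have hQ : ‖((Real.sqrt a : ℝ) : ℂ) • QtorusW L m hL φ Ũ hα1Ũ hU1Ũ hregŨ (c₁ := c₁) Ag‖ =
      ‖((Real.sqrt a : ℝ) : ℂ) • QtorusW L m hL φ V hα1 hU1 hreg (c₁ := c₁) A‖ := by
    rw [hAg, QtorusW_gauge_transfer_of_support L m hL φ V Ũ hα1 hα1Ũ hU1 hreg hU1g hregg hU1Ũ hregŨ hm Y hagree A hA, norm_smul,
      norm_smul, norm_gaugeW φ _ (fun c => hAd _)]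
  -- the two Lipschitz letters at `Ũ`'s global window
  have hD : ‖covCurlL2K ℂ c₀ ((η : ℂ))⁻¹ (adTransportW φ Ũ) Ag -
        covCurlL2K ℂ c₀ ((η : ℂ))⁻¹ (adTransportW φ fun _ : Bond d (fineP L m) => (1 : 𝔸ˣ)) Ag‖ ≤
      4 * Real.sqrt d * (‖((η : ℂ))⁻¹‖ * (2 * Mφ * Mφ' * ((l1 (fun i => (L : ℤ) * (N i + 3)) : ℝ) * δ))) * ‖Ag‖ :=
    norm_covCurlL2K_sub_le ((η : ℂ))⁻¹ (by positivity)
      (fun b w => norm_adTransportW_sub_le φ hφ hφ' hMφ' Ũ b (hŨ1 b) (hŨε b) w) (fun b w => adTransportW_one_apply L m φ b w) Ag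
  have hQL := norm_QtorusW_sub_flat_le_local L m hL Ũ hα1Ũ hU1Ũ hregŨ hα1' hU1' hreg' hEPS0 hŨε φ (c₀ := c₀) (c₁ := c₁)
    hMφ hφ hMφ' hφ' Ag
  -- the flat inequality at `A^g`
  have hF := hflat Ag hAgT hAg0
  -- squares
  set CD : ℝ := 4 * Real.sqrt d * (‖((η : ℂ))⁻¹‖ * (2 * Mφ * Mφ' * ((l1 (fun i => (L : ℤ) * (N i + 3)) : ℝ) * δ))) with hCD
  set CQ : ℝ := Mφ' * Mφ * Real.sqrt (2 * d * c₁ / c₀) * (102 * (d + 1) ^ 2 * L * ((l1 (fun i => (L : ℤ) * (N i + 3)) : ℝ) * δ)) with hCQ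
  have hCD0 : 0 ≤ CD := by rw [hCD]; positivity
  have hCQ0 : 0 ≤ CQ := by
    rw [hCQ]
    have : (0 : ℝ) ≤ 2 * d * c₁ / c₀ := by
      have hc₀ : 0 < c₀ := Fact.out
      have hc₁ : 0 < c₁ := Fact.out
      positivity
    positivity
  have hsa : ‖((Real.sqrt a : ℝ) : ℂ)‖ = Real.sqrt a := by
    rw [Complex.norm_real, Real.norm_eq_abs, abs_of_nonneg (Real.sqrt_nonneg _)]
  have hD2 : ‖covCurlL2K ℂ c₀ ((η : ℂ))⁻¹ (adTransportW φ Ũ) Ag -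
        covCurlL2K ℂ c₀ ((η : ℂ))⁻¹ (adTransportW φ fun _ : Bond d (fineP L m) => (1 : 𝔸ˣ)) Ag‖ ^ 2 ≤ CD ^ 2 * ‖A‖ ^ 2 := by
    rw [← mul_pow, ← hnA]; exact pow_le_pow_left₀ (norm_nonneg _) hD 2
  have hQ2 : ‖((Real.sqrt a : ℝ) : ℂ) • QtorusW L m hL φ Ũ hα1Ũ hU1Ũ hregŨ (c₁ := c₁) Ag -
        ((Real.sqrt a : ℝ) : ℂ) • QtorusW L m hL φ (fun _ : Bond d (fineP L m) => (1 : 𝔸ˣ)) hα1' hU1' hreg' (c₁ := c₁) Ag‖ ^ 2 ≤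
      a * CQ ^ 2 * ‖A‖ ^ 2 := by
    have hQL2 := pow_le_pow_left₀ (norm_nonneg _) hQL 2
    rw [← smul_sub, norm_smul, hsa, mul_pow, Real.sq_sqrt ha, ← hnA]
    calc _ ≤ a * (CQ * ‖Ag‖) ^ 2 := mul_le_mul_of_nonneg_left hQL2 ha
      _ = a * CQ ^ 2 * ‖Ag‖ ^ 2 := by ring
  -- §0 twice and assemble
  have h1 := half_sq_sub_le (covCurlL2K ℂ c₀ ((η : ℂ))⁻¹ (adTransportW φ Ũ) Ag)
    (covCurlL2K ℂ c₀ ((η : ℂ))⁻¹ (adTransportW φ fun _ : Bond d (fineP L m) => (1 : 𝔸ˣ)) Ag)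
  have h2 := half_sq_sub_le (((Real.sqrt a : ℝ) : ℂ) • QtorusW L m hL φ Ũ hα1Ũ hU1Ũ hregŨ (c₁ := c₁) Ag)
    (((Real.sqrt a : ℝ) : ℂ) • QtorusW L m hL φ (fun _ : Bond d (fineP L m) => (1 : 𝔸ˣ)) hα1' hU1' hreg' (c₁ := c₁) Ag)
  rw [hnA] at hF
  rw [← hcurl, ← hQ]
  nlinarith [h1, h2, hD2, hQ2, hF]

/-! ## §2 (loc) on every cube of the tree's partition — EXACTLY the `hloc` binder of companion 5's `h2_of_loc` (N9:722), `R := Ad V` -/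

include hAdU hMφ hMφ' hφ hφ' hU hUstar hδ0 hδ in
/-- **JUNCTION J1b — E1 LEMMA 5.5 (loc) AT `V` FROM J1a + THE GEOMETRY LETTER, IN COMPANION 5's SHAPE.**  Data: the tree's partition of unity
`B5SmoothPartition.hS` at scale `M₀` sampled on fine bonds (`χB`, `hχB` — companion 5's N9:80–84 verbatim); coarse extents `N` with
`N_i + 4 ≤ m_i` and `|L(N+3)|₁·δ ≤ 1∕(256(d+1)²L^{d+1})`.  DISPLAYED: (G1) `hgeo` — every `χ^z` is block-supported in some coarse cube
`y₁ + [1, N+1]` (a fact about `hS`: `supp χ^z ⊆ z + [−M₀, 2M₀)^d`, so `N_i = ⌈3M₀∕L⌉ + 1` works when `3M₀ + 4L ≤ L·m_i`; NOT proved here);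
(J1a) `hflat` — the flat axial inequality, constant `γ_f`, for fields vanishing on `T` and supported over ANY such cube.  CONCLUSION: for every
submodule `𝒜` of fields vanishing on `T` (E1: `𝒜 = 𝒜_Λ ∩ {axial on the k-blocks}`), every cube `z` and every `B ∈ 𝒜`,
`γ·‖χ^z B‖² ≤ ‖curl_V(χ^z B)‖² + ‖√a•Q(V)(χ^z B)‖²` with `γ = γ_f∕2 − (C_D² + a·C_Q²)` of §1 — the `hloc` binder of companion 5's
`h2_of_loc` with `R := adTransportW φ V` (so `M_T = 1` there for unitary `V`).  With companion 5: E1 Prop. 5.6 (h2) at `V` ⟸ J1a + G1 + tree.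
[cite: Balaban1985BackgroundPropagators, (3.35)–(3.36) p.396, Cor 3.6 p.408; Balaban1984PropagatorsII, Lemma 2.4 (2.128) p.245;
Balaban1987RG1, (1.11)–(1.12) p.262, Thm 2 + (0.31) p.259] -/
theorem hloc_axial_of_flat
    {M₀ : ℕ} (χB : Ctr (fineP L m) M₀ → BondL2K ℂ d (fineP L m) c₀ W →L[ℂ] BondL2K ℂ d (fineP L m) c₀ W)
    (hχB : ∀ z (A : BondL2K ℂ d (fineP L m) c₀ W) (b : Bond d (fineP L m)),
      WL2.equiv ℂ _ W (χB z A) b = (hS (fineP L m) M₀ z (bpos b) : ℂ) • WL2.equiv ℂ _ W A b)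
    {N : B7Prop1Explicit.Site d} (hNm : ∀ i, N i + 4 ≤ (m i : ℤ))
    (hw : (l1 (fun i => (L : ℤ) * (N i + 3)) : ℝ) * δ ≤ 1 / (256 * ((d : ℝ) + 1) ^ 2 * (L : ℝ) ^ (d + 1)))
    (hgeo : ∀ z : Ctr (fineP L m) M₀, ∃ (y₁ : TSite d m) (Y : Set (TSite d m)),
      (∀ y ∈ Y, ∀ i, 1 ≤ liftSite (y - y₁) i ∧ liftSite (y - y₁) i ≤ N i + 1) ∧
        ∀ b : Bond d (fineP L m), blockCoord L m (bpos b) ∉ Y → hS (fineP L m) M₀ z (bpos b) = 0)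
    (T : Set (Bond d (fineP L m))) {a γf : ℝ} (ha : 0 ≤ a)
    (hflat : ∀ (y₁ : TSite d m) (Y : Set (TSite d m)),
      (∀ y ∈ Y, ∀ i, 1 ≤ liftSite (y - y₁) i ∧ liftSite (y - y₁) i ≤ N i + 1) →
      ∀ A' : BondL2K ℂ d (fineP L m) c₀ W, (∀ b ∈ T, WL2.equiv ℂ _ W A' b = 0) →
        (∀ b : Bond d (fineP L m), blockCoord L m (bpos b) ∉ Y → WL2.equiv ℂ _ W A' b = 0) →
        γf * ‖A'‖ ^ 2 ≤ ‖covCurlL2K ℂ c₀ ((η : ℂ))⁻¹ (adTransportW φ fun _ : Bond d (fineP L m) => (1 : 𝔸ˣ)) A'‖ ^ 2 +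
          ‖((Real.sqrt a : ℝ) : ℂ) • QtorusW L m hL φ (fun _ : Bond d (fineP L m) => (1 : 𝔸ˣ)) hα1' hU1' hreg' (c₁ := c₁) A'‖ ^ 2)
    (𝒜 : Submodule ℂ (BondL2K ℂ d (fineP L m) c₀ W)) (h𝒜T : ∀ B ∈ 𝒜, ∀ b ∈ T, WL2.equiv ℂ _ W B b = 0) :
    ∀ (z : Ctr (fineP L m) M₀), ∀ B ∈ 𝒜,
      (γf / 2 - ((4 * Real.sqrt d * (‖((η : ℂ))⁻¹‖ * (2 * Mφ * Mφ' * ((l1 (fun i => (L : ℤ) * (N i + 3)) : ℝ) * δ)))) ^ 2 +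
          a * (Mφ' * Mφ * Real.sqrt (2 * d * c₁ / c₀) * (102 * (d + 1) ^ 2 * L * ((l1 (fun i => (L : ℤ) * (N i + 3)) : ℝ) * δ))) ^ 2)) *
          ‖χB z B‖ ^ 2 ≤
        ‖covCurlL2K ℂ c₀ ((η : ℂ))⁻¹ (adTransportW φ V) (χB z B)‖ ^ 2 +
          ‖((Real.sqrt a : ℝ) : ℂ) • QtorusW L m hL φ V hα1 hU1 hreg (c₁ := c₁) (χB z B)‖ ^ 2 := by
  intro z B hB
  obtain ⟨y₁, Y, hY, hsupp⟩ := hgeo z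
  refine cube_axial_of_flat L hL m φ hAdU hMφ hMφ' hφ hφ' η V hU hUstar hα1 hU1 hreg hα1' hU1' hreg' hδ0 hδ y₁ hNm Y hY hw T ha
    (hflat y₁ Y hY) (χB z B) ?_ ?_
  · intro b hb
    rw [hχB, hsupp b hb]
    simp
  · intro b hb
    rw [hχB, h𝒜T B hB b hb, smul_zero]

/-! ## §3 The geometry letter G1 DISCHARGED: the tree's cube placement (`B9Eq387CubeReductionGeometry.exists_box_of_ctr`, collars `0`) -/

/-- **G1 from the tree.**  For the `M₀`-cover of the fine torus with `1 ≤ M₀ ≤ Lρ` and `2ρ + 4 ≤ m_i` (the cube's coarse `ρ`-ball does not wrap), every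
partition function `hS_z` is block-supported in a coarse cube `y₁ + [1, 2ρ+1]`: the tree's `exists_box_of_ctr` at collar radii `r₀ = R = 0`
(`hS_z(x) = 0` at fine distance `≥ M₀` from the centre, [B6-I] (1.118); `L·d_m − (L−1) ≤ d_{Lm}`).  This is the `hgeo` binder of `hloc_axial_of_flat`
with the constant extent `N_i = 2ρ`. [cite: Balaban1984PropagatorsI, (1.118) p.36; Balaban1985BackgroundPropagators, p.408] -/
theorem hgeo_of_partition {M₀ : ℕ} (hM : 1 ≤ M₀) {ρ : ℕ} (hρ : M₀ ≤ L * ρ) (hfit : ∀ i, 2 * ρ + 4 ≤ m i)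
    (z : Ctr (fineP L m) M₀) :
    ∃ (y₁ : TSite d m) (Y : Set (TSite d m)),
      (∀ y ∈ Y, ∀ i, 1 ≤ liftSite (y - y₁) i ∧ liftSite (y - y₁) i ≤ ((2 * ρ : ℕ) : ℤ) + 1) ∧
        ∀ b : Bond d (fineP L m), blockCoord L m (bpos b) ∉ Y → hS (fineP L m) M₀ z (bpos b) = 0 := by
  have hP : ∀ i, 1 ≤ fineP L m i := fun i => Nat.one_le_iff_ne_zero.mpr (NeZero.ne (fineP L m i))
  obtain ⟨y₁, Z₀, -, hZ₀, hsupp⟩ :=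
    B9Eq387CubeReductionGeometry.exists_box_of_ctr L hP hM hρ 0 0 (fun i => by have := hfit i; omega) z
  refine ⟨y₁, (↑Z₀ : Set (TSite d m)), fun y hy i => ?_, fun b hb => hsupp (bpos b) fun h => hb (Finset.mem_coe.mpr h)⟩
  obtain ⟨h1, h2⟩ := hZ₀ y (Finset.mem_coe.mp hy) i
  push_cast at h1 h2 ⊢
  constructor <;> omega

include hAdU hMφ hMφ' hφ hφ' hU hUstar hδ0 hδ in
/-- **J1b CLOSED UP TO J1a** — `hloc_axial_of_flat` with the geometry letter supplied by `hgeo_of_partition`: for the tree's partition at scale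
`M₀` (`1 ≤ M₀ ≤ Lρ`, `2ρ + 4 ≤ m_i`), a unit-bounded unitary `V` with plaquettes `δ`-close to `1` and `|L(2ρ+3)|₁·δ ≤ 1∕(256(d+1)²L^{d+1})`,
the ONLY displayed analytic input is `hflat` = J1a ([B6] Lemma 2.4′ at `U = 1` for `T`-axial fields over coarse cubes of extent `2ρ`, constant `γ_f`);
output = companion 5's `hloc` (N9:722) with `R := Ad V`, `γ = γ_f∕2 − (C_D² + a·C_Q²)` at `ε_g = |L(2ρ+3)|₁·δ`.
[cite: Balaban1987RG1, (1.11)–(1.12) p.262, Thm 2 + (0.31) p.259; Balaban1985BackgroundPropagators, (3.35)–(3.36) p.396, Cor 3.6 p.408; Balaban1984PropagatorsII, Lemma 2.4 (2.128) p.245] -/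
theorem hloc_axial_of_flat₀
    {M₀ : ℕ} (hM : 1 ≤ M₀) {ρ : ℕ} (hρ : M₀ ≤ L * ρ) (hfit : ∀ i, 2 * ρ + 4 ≤ m i)
    (χB : Ctr (fineP L m) M₀ → BondL2K ℂ d (fineP L m) c₀ W →L[ℂ] BondL2K ℂ d (fineP L m) c₀ W)
    (hχB : ∀ z (A : BondL2K ℂ d (fineP L m) c₀ W) (b : Bond d (fineP L m)),
      WL2.equiv ℂ _ W (χB z A) b = (hS (fineP L m) M₀ z (bpos b) : ℂ) • WL2.equiv ℂ _ W A b)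
    (hw : (l1 (fun _ : Fin d => (L : ℤ) * (((2 * ρ : ℕ) : ℤ) + 3)) : ℝ) * δ ≤ 1 / (256 * ((d : ℝ) + 1) ^ 2 * (L : ℝ) ^ (d + 1)))
    (T : Set (Bond d (fineP L m))) {a γf : ℝ} (ha : 0 ≤ a)
    (hflat : ∀ (y₁ : TSite d m) (Y : Set (TSite d m)),
      (∀ y ∈ Y, ∀ i, 1 ≤ liftSite (y - y₁) i ∧ liftSite (y - y₁) i ≤ ((2 * ρ : ℕ) : ℤ) + 1) →
      ∀ A' : BondL2K ℂ d (fineP L m) c₀ W, (∀ b ∈ T, WL2.equiv ℂ _ W A' b = 0) →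
        (∀ b : Bond d (fineP L m), blockCoord L m (bpos b) ∉ Y → WL2.equiv ℂ _ W A' b = 0) →
        γf * ‖A'‖ ^ 2 ≤ ‖covCurlL2K ℂ c₀ ((η : ℂ))⁻¹ (adTransportW φ fun _ : Bond d (fineP L m) => (1 : 𝔸ˣ)) A'‖ ^ 2 +
          ‖((Real.sqrt a : ℝ) : ℂ) • QtorusW L m hL φ (fun _ : Bond d (fineP L m) => (1 : 𝔸ˣ)) hα1' hU1' hreg' (c₁ := c₁) A'‖ ^ 2)
    (𝒜 : Submodule ℂ (BondL2K ℂ d (fineP L m) c₀ W)) (h𝒜T : ∀ B ∈ 𝒜, ∀ b ∈ T, WL2.equiv ℂ _ W B b = 0) :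
    ∀ (z : Ctr (fineP L m) M₀), ∀ B ∈ 𝒜,
      (γf / 2 - ((4 * Real.sqrt d * (‖((η : ℂ))⁻¹‖ * (2 * Mφ * Mφ' * ((l1 (fun _ : Fin d => (L : ℤ) * (((2 * ρ : ℕ) : ℤ) + 3)) : ℝ) * δ)))) ^ 2 +
          a * (Mφ' * Mφ * Real.sqrt (2 * d * c₁ / c₀) * (102 * (d + 1) ^ 2 * L * ((l1 (fun _ : Fin d => (L : ℤ) * (((2 * ρ : ℕ) : ℤ) + 3)) : ℝ) * δ))) ^ 2)) *
          ‖χB z B‖ ^ 2 ≤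
        ‖covCurlL2K ℂ c₀ ((η : ℂ))⁻¹ (adTransportW φ V) (χB z B)‖ ^ 2 +
          ‖((Real.sqrt a : ℝ) : ℂ) • QtorusW L m hL φ V hα1 hU1 hreg (c₁ := c₁) (χB z B)‖ ^ 2 :=
  hloc_axial_of_flat L hL m φ hAdU hMφ hMφ' hφ hφ' η V hU hUstar hα1 hU1 hreg hα1' hU1' hreg' hδ0 hδ χB hχB
    (N := fun _ => ((2 * ρ : ℕ) : ℤ)) (fun i => by have := hfit i; push_cast; omega) hw
    (fun z => hgeo_of_partition L m hM hρ hfit z) T ha hflat 𝒜 h𝒜T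

/-! ## §4 The transport letter of companion 5 at `R := Ad V`: `M_T = 1` for unitary `V` (tree theorem by name) -/

omit [NeZero L] [∀ i, NeZero (m i)] [∀ i, NeZero (fineP L m i)] [NormOneClass 𝔸] [CompleteSpace 𝔸] in
include hAdU hUstar in
/-- Companion 5's binders `hMT : 0 ≤ M_T`, `hR : ‖R b v‖ ≤ M_T‖v‖` for `R := adTransportW φ V` hold with `M_T = 1` when `V` is unitary and `R(u)` is
fibrewise isometric for unitary `u` — the tree's `B9Eq387CubeReductionGaugeBackground.norm_adTransportW_eq_of_unitary`.  So in `h2_of_loc` (N9:722) fed by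
`hloc_axial_of_flat`: `b₁ = (16d·2 + 8d)·64∕(M₀η)² = 2560d∕(M₀η)²`. [cite: Balaban1985BackgroundPropagators, (3.28)–(3.30) p.395] -/
theorem hR_unitary : ∀ (b : Bond d (fineP L m)) (v : W), ‖adTransportW φ V b v‖ ≤ 1 * ‖v‖ := fun b v => by
  rw [one_mul]; exact (B9Eq387CubeReductionGaugeBackground.norm_adTransportW_eq_of_unitary φ hAdU V hUstar b v).le

/-! ## §3  The compositions with modules 2 and 4: (loc) from `Rreal`, from the torus (2.128) binder, and with no such binder for `T ⊇` the block axial trees -/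

include hAdU hMφ hMφ' hφ hφ' hU hUstar hδ0 hδ hα1' hU1' hreg' in
/-- **(loc) from `Rreal`.**  E1 Lemma 5.5 (the local step of the p. 428 localisation) at every block-regular unitary `V`, for bond functions vanishing on `T`,
from the REAL explicit-sum inequality `Rreal(γ_f)` alone (module 4 `NodeOFlatAxial.hflat_of_Rreal` feeding `hloc_axial_of_flat₀`).
[cite: Balaban1985BackgroundPropagators, p.428, (3.35)–(3.36) p.396; Balaban1984PropagatorsII, Lemma 2.4 (2.128) p.245] -/
theorem hloc_axial_of_Rreal [FiniteDimensional ℂ W]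
    {M₀ : ℕ} (hM : 1 ≤ M₀) {ρ : ℕ} (hρ : M₀ ≤ L * ρ) (hfit : ∀ i, 2 * ρ + 4 ≤ m i)
    (χB : Ctr (fineP L m) M₀ → BondL2K ℂ d (fineP L m) c₀ W →L[ℂ] BondL2K ℂ d (fineP L m) c₀ W)
    (hχB : ∀ z (A : BondL2K ℂ d (fineP L m) c₀ W) (b : Bond d (fineP L m)),
      WL2.equiv ℂ _ W (χB z A) b = (hS (fineP L m) M₀ z (bpos b) : ℂ) • WL2.equiv ℂ _ W A b)
    (hw : (l1 (fun _ : Fin d => (L : ℤ) * (((2 * ρ : ℕ) : ℤ) + 3)) : ℝ) * δ ≤ 1 / (256 * ((d : ℝ) + 1) ^ 2 * (L : ℝ) ^ (d + 1)))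
    (T : Set (Bond d (fineP L m))) {a γf : ℝ} (ha : 0 ≤ a)
    (hRreal : ∀ (y₁ : TSite d m) (Y : Set (TSite d m)),
      (∀ y ∈ Y, ∀ i, 1 ≤ liftSite (y - y₁) i ∧ liftSite (y - y₁) i ≤ ((2 * ρ : ℕ) : ℤ) + 1) →
      ∀ B : Bond d (fineP L m) → ℝ, (∀ b ∈ T, B b = 0) → (∀ b, blockCoord L m (bpos b) ∉ Y → B b = 0) →
        γf * (c₀ * ∑ b, B b ^ 2) ≤
          c₀ * η⁻¹ ^ 2 * ∑ p, NodeOTorusBlocks.curlSum B p ^ 2 + a * c₁ * ((L : ℝ) ^ (d + 1))⁻¹ ^ 2 * ∑ c, NodeOTorusBlocks.qSum L m B c ^ 2)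
    (𝒜 : Submodule ℂ (BondL2K ℂ d (fineP L m) c₀ W)) (h𝒜T : ∀ B ∈ 𝒜, ∀ b ∈ T, WL2.equiv ℂ _ W B b = 0) :
    ∀ (z : Ctr (fineP L m) M₀), ∀ B ∈ 𝒜,
      (γf / 2 - ((4 * Real.sqrt d * (‖((η : ℂ))⁻¹‖ * (2 * Mφ * Mφ' * ((l1 (fun _ : Fin d => (L : ℤ) * (((2 * ρ : ℕ) : ℤ) + 3)) : ℝ) * δ)))) ^ 2 +
          a * (Mφ' * Mφ * Real.sqrt (2 * d * c₁ / c₀) * (102 * (d + 1) ^ 2 * L * ((l1 (fun _ : Fin d => (L : ℤ) * (((2 * ρ : ℕ) : ℤ) + 3)) : ℝ) * δ))) ^ 2)) *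
          ‖χB z B‖ ^ 2 ≤
        ‖covCurlL2K ℂ c₀ ((η : ℂ))⁻¹ (adTransportW φ V) (χB z B)‖ ^ 2 +
          ‖((Real.sqrt a : ℝ) : ℂ) • QtorusW L m hL φ V hα1 hU1 hreg (c₁ := c₁) (χB z B)‖ ^ 2 :=
  hloc_axial_of_flat₀ L hL m φ hAdU hMφ hMφ' hφ hφ' η V hU hUstar hα1 hU1 hreg hα1' hU1' hreg' hδ0 hδ hM hρ hfit χB hχB hw T ha
    (NodeOFlatAxial.hflat_of_Rreal L m hL φ hα1' hU1' hreg' η T ha hRreal) 𝒜 h𝒜T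

include hAdU hMφ hMφ' hφ hφ' hU hUstar hδ0 hδ hα1' hU1' hreg' in
/-- **(loc) from the unit-weight torus (2.128).**  E1 Lemma 5.5 at every block-regular unitary `V` with `γ_f = k·min{η⁻², a·c₁∕(c₀·w_Q)}`, from the
unit-weight TORUS form of (2.128) with constant `k` and `Q`-weight `w_Q` as a binder (module 4 `NodeOFlatAxial.Rreal_of_unitWeight`); any `T`.
[cite: Balaban1984PropagatorsII, Lemma 2.4 (2.128) p.245; Balaban1985BackgroundPropagators, p.428, (3.35)–(3.36) p.396] -/
theorem hloc_axial_of_torus2128 [FiniteDimensional ℂ W]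
    {M₀ : ℕ} (hM : 1 ≤ M₀) {ρ : ℕ} (hρ : M₀ ≤ L * ρ) (hfit : ∀ i, 2 * ρ + 4 ≤ m i)
    (χB : Ctr (fineP L m) M₀ → BondL2K ℂ d (fineP L m) c₀ W →L[ℂ] BondL2K ℂ d (fineP L m) c₀ W)
    (hχB : ∀ z (A : BondL2K ℂ d (fineP L m) c₀ W) (b : Bond d (fineP L m)),
      WL2.equiv ℂ _ W (χB z A) b = (hS (fineP L m) M₀ z (bpos b) : ℂ) • WL2.equiv ℂ _ W A b)
    (hw : (l1 (fun _ : Fin d => (L : ℤ) * (((2 * ρ : ℕ) : ℤ) + 3)) : ℝ) * δ ≤ 1 / (256 * ((d : ℝ) + 1) ^ 2 * (L : ℝ) ^ (d + 1)))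
    (T : Set (Bond d (fineP L m))) {a k wQ : ℝ} (ha : 0 ≤ a) (hwQ : 0 < wQ)
    (h2128 : ∀ (y₁ : TSite d m) (Y : Set (TSite d m)),
      (∀ y ∈ Y, ∀ i, 1 ≤ liftSite (y - y₁) i ∧ liftSite (y - y₁) i ≤ ((2 * ρ : ℕ) : ℤ) + 1) →
      ∀ B : Bond d (fineP L m) → ℝ, (∀ b ∈ T, B b = 0) → (∀ b, blockCoord L m (bpos b) ∉ Y → B b = 0) →
        k * ∑ b, B b ^ 2 ≤
          wQ * ∑ c, (((L : ℝ) ^ (d + 1))⁻¹ * NodeOTorusBlocks.qSum L m B c) ^ 2 + ∑ p, NodeOTorusBlocks.curlSum B p ^ 2)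
    (𝒜 : Submodule ℂ (BondL2K ℂ d (fineP L m) c₀ W)) (h𝒜T : ∀ B ∈ 𝒜, ∀ b ∈ T, WL2.equiv ℂ _ W B b = 0) :
    ∀ (z : Ctr (fineP L m) M₀), ∀ B ∈ 𝒜,
      (min (c₀ * η⁻¹ ^ 2) (a * c₁ / wQ) * k / c₀ / 2 - ((4 * Real.sqrt d * (‖((η : ℂ))⁻¹‖ * (2 * Mφ * Mφ' * ((l1 (fun _ : Fin d => (L : ℤ) * (((2 * ρ : ℕ) : ℤ) + 3)) : ℝ) * δ)))) ^ 2 +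
          a * (Mφ' * Mφ * Real.sqrt (2 * d * c₁ / c₀) * (102 * (d + 1) ^ 2 * L * ((l1 (fun _ : Fin d => (L : ℤ) * (((2 * ρ : ℕ) : ℤ) + 3)) : ℝ) * δ))) ^ 2)) *
          ‖χB z B‖ ^ 2 ≤
        ‖covCurlL2K ℂ c₀ ((η : ℂ))⁻¹ (adTransportW φ V) (χB z B)‖ ^ 2 +
          ‖((Real.sqrt a : ℝ) : ℂ) • QtorusW L m hL φ V hα1 hU1 hreg (c₁ := c₁) (χB z B)‖ ^ 2 :=
  hloc_axial_of_Rreal L hL m φ hAdU hMφ hMφ' hφ hφ' η V hU hUstar hα1 hU1 hreg hα1' hU1' hreg' hδ0 hδ hM hρ hfit χB hχB hw T ha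
    (NodeOFlatAxial.Rreal_of_unitWeight L m η T ha hwQ h2128) 𝒜 h𝒜T

include hAdU hMφ hMφ' hφ hφ' hU hUstar hδ0 hδ hα1' hU1' hreg' in
/-- **(loc) with NO (2.128)-type binder.**  E1 Lemma 5.5 at every block-regular unitary `V`.  Hypotheses: the frame (`hAdU … hδ`), block-regularity of `V`
and of `1` (`hα1 hU1 hreg`, `hα1' hU1' hreg'`), the window∕fit numerics (`hM hρ hfit hw`), the cube partition (`χB hχB`), `d ≥ 2`, and an axial gauge
`T ⊇ NodeOTorusBlocks.axialTrees` (the periodic image of the (1.7)∕(2.121) block contours); constant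
`γ_f = (κ₁∕(12d²))·L^{−(d+1)}·min{η⁻², a·c₁∕(c₀L^{d−2})}`, `κ₁ = B6LayerPoincarePair.kappa1 d L`.  Chain: `hloc_axial_of_flat₀` ∘ `NodeOFlatAxial.hflat_of_Rreal` ∘
`NodeOFlatAxial.Rreal_of_unitWeight` ∘ `NodeOTorusLemma24.torus2128_of_Zd` ∘ `B6Lemma24Kappa.lemma24_printedShape_kappa1`.
[cite: Balaban1985BackgroundPropagators, p.428, (3.35)–(3.36) p.396; Balaban1984PropagatorsII, Lemma 2.4 (2.128) p.245, (2.121) p.244] -/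
theorem hloc_axial_of_lemma24 [FiniteDimensional ℂ W]
    {M₀ : ℕ} (hM : 1 ≤ M₀) {ρ : ℕ} (hρ : M₀ ≤ L * ρ) (hfit : ∀ i, 2 * ρ + 4 ≤ m i)
    (χB : Ctr (fineP L m) M₀ → BondL2K ℂ d (fineP L m) c₀ W →L[ℂ] BondL2K ℂ d (fineP L m) c₀ W)
    (hχB : ∀ z (A : BondL2K ℂ d (fineP L m) c₀ W) (b : Bond d (fineP L m)),
      WL2.equiv ℂ _ W (χB z A) b = (hS (fineP L m) M₀ z (bpos b) : ℂ) • WL2.equiv ℂ _ W A b)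
    (hw : (l1 (fun _ : Fin d => (L : ℤ) * (((2 * ρ : ℕ) : ℤ) + 3)) : ℝ) * δ ≤ 1 / (256 * ((d : ℝ) + 1) ^ 2 * (L : ℝ) ^ (d + 1)))
    (T : Set (Bond d (fineP L m))) {a : ℝ} (ha : 0 ≤ a)
    (hd : 2 ≤ d) (hTax : NodeOTorusBlocks.axialTrees L m ⊆ T)
    (𝒜 : Submodule ℂ (BondL2K ℂ d (fineP L m) c₀ W)) (h𝒜T : ∀ B ∈ 𝒜, ∀ b ∈ T, WL2.equiv ℂ _ W B b = 0) :
    ∀ (z : Ctr (fineP L m) M₀), ∀ B ∈ 𝒜,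
      (min (c₀ * η⁻¹ ^ 2) (a * c₁ / ((L : ℝ) ^ ((d : ℝ) - 2))) * (B6LayerPoincarePair.kappa1 d L / (12 * (d : ℝ) ^ 2) * (L : ℝ) ^ (-((d : ℝ) + 1))) / c₀ / 2 - ((4 * Real.sqrt d * (‖((η : ℂ))⁻¹‖ * (2 * Mφ * Mφ' * ((l1 (fun _ : Fin d => (L : ℤ) * (((2 * ρ : ℕ) : ℤ) + 3)) : ℝ) * δ)))) ^ 2 +
          a * (Mφ' * Mφ * Real.sqrt (2 * d * c₁ / c₀) * (102 * (d + 1) ^ 2 * L * ((l1 (fun _ : Fin d => (L : ℤ) * (((2 * ρ : ℕ) : ℤ) + 3)) : ℝ) * δ))) ^ 2)) *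
          ‖χB z B‖ ^ 2 ≤
        ‖covCurlL2K ℂ c₀ ((η : ℂ))⁻¹ (adTransportW φ V) (χB z B)‖ ^ 2 +
          ‖((Real.sqrt a : ℝ) : ℂ) • QtorusW L m hL φ V hα1 hU1 hreg (c₁ := c₁) (χB z B)‖ ^ 2 :=
  hloc_axial_of_torus2128 L hL m φ hAdU hMφ hMφ' hφ hφ' η V hU hUstar hα1 hU1 hreg hα1' hU1' hreg' hδ0 hδ hM hρ hfit χB hχB hw T ha
    (Real.rpow_pos_of_pos (Nat.cast_pos.2 (by omega)) _)
    (fun y₁ Y hY B hT hY0 => NodeOTorusLemma24.torus2128_of_Zd L m hd hL (fun i => by have := hfit i; omega) T hTax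
      y₁ Y hY B hT hY0) 𝒜 h𝒜T

end Cube

end Literature.MathematicalPhysics.QuantumFieldTheory.Balaban1983to89.NodeOLocAxial

end
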